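import Summits.CriticalPhenomena.PercolationContinuityZ3.Theorems.Transplant.FKConnectivityAllQAntipodalWeightUpc
import Summits.CriticalPhenomena.PercolationContinuityZ3.Theorems.Transplant.FKConnectivityAllQAntipodalLevel4
import Summits.CriticalPhenomena.PercolationContinuityZ3.Theorems.Transplant.FKConnectivityAllQAntipodalLevel3All
import HarnessLib

/-!
# Connectivity correlation inequalities for `φ_{w,q}`, every `q > 0` — file 46: the `q`-FREE (LEVEL) FORM of the antipodal
# covariance inequality `C_∞` — Abel bridge, and levels 1 and 2 on two-terminal series–parallel networks

Support file (`--supports stmt-CriticalPhenomena-4575`), FK sub-lane `prim-bschramm-fk-2` (gen 21); builds on p205010 (kernel theorem,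
internal audit signed; external expert review pending).  No definitions, no named facts, no sorries; standard axioms.

CONTEXT.  Gen 10's Conjecture `C_∞` (FK-Q2 §19) says that on a 2-connected series–parallel graph `H`, for `0 < q ≤ 1` and increasing
`f, g` reading disjoint edge sets, the antipodal form `apPsi q H f g = ∑_{γ ⊆ H} q^{k(γ)+k(H∖γ)} (f γ − f γᶜ)(g γ − g γᶜ)` is `≤ 0`
(all square-free coefficients of `Z_H² Cov_{φ_{z,q}}(f,g)` are `≤ 0`); gens 11–20 proved it through level 3 (`|supp f| ≤ 3`) and for the
AND type at every level.  Gen 21's census (memo FROM-fk-2-g21, FK-Q2 §30) found that in every one of 4.6·10⁶ exact instances the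
STRONGER `q`-free statement holds: for EVERY cluster level `J`,
`∑_{γ ⊆ H : k(γ)+k(H∖γ) ≤ J} (f γ − f γᶜ)(g γ − g γᶜ) ≤ 0`                                                    (C_∞⁺, level form)
equivalently `apPsi q H f g / (q − 1)` is a polynomial in `q` with NONNEGATIVE coefficients (so that the same polynomial certifies negative
association for `q < 1`, independence at `q = 1` and positive association for `q > 1`), equivalently: under the UNIFORM measure on the
complementary pairs `(γ, H∖γ)` with at most `J` clusters in total, the odd parts of `f` and `g` are negatively correlated.  This file puts
the level form on the record in the kernel where the existing machinery gives it at once: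
* `FK.sum_pow_mul_nonpos_of_levels_le` — ABEL BRIDGE: if all level partial sums `∑_{e(i) ≤ J} a_i` are `≤ 0` then `∑ q^{e(i)} a_i ≤ 0` for
  every `0 ≤ q ≤ 1`; hence (`FK.apPsi_nonpos_of_levels_le_nonpos`) the level form of `C_∞` implies `C_∞`.
* `FK.apPsiW_pivot_eq` — integrating out a pivot edge `x = st` against an ARBITRARY level weight `w : ℕ → ℝ`:
  `∑_{γ ⊆ M ∪ {x}} w(k(γ)+k(γᶜ)) (1_x γ − 1_x γᶜ)(g γ − g γᶜ) = − apUpcLW (n ↦ w(n−1) − w(n)) M s t (γ ↦ g γ − g(M∖γ))`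
  (the weighted form of gen 11's `FK.apPsi_edge_eq`: the factor `q − 1` becomes the backward DIFFERENCE of the weight sequence).
* `FK.apPsiW_pivot_nonpos_of_isTTSP`, `FK.apPsiW_pivot_sub_nonpos_of_isTTSP` — for every ANTITONE weight `w` (in particular `w = 1_{· ≤ J}`:
  `FK.apPsi_levels_le_pivot_nonpos_of_isTTSP`) and every sub-host `M` of a 2-connected series–parallel graph, the weighted antipodal form of
  `1_x` against any increasing `g` not reading `x` is `≤ 0` — gen 18's coefficientwise Theorem U (`FK.apUpcLW_nonneg_of_isTTSP`) re-read as
  the level form of `C_∞` at `|supp f| = 1`, at any position (Duffin re-rooting `FK.IsTTSP.reroot_erase`).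
* `FK.apPsiW_level2_nonpos_of_isTTSP` (+ `FK.apPsi_levels_le_level2_nonpos_of_isTTSP`) — the level form of `C_∞` for EVERY increasing `f`
  reading two edges `a, b`: pointwise `f γ − f γᶜ = α (1_a γ − 1_a γᶜ) + β (1_b γ − 1_b γᶜ)` with `α, β ≥ 0`.
Level 3 is NOT obtained this way: the census shows that gen 16's auxiliary inequality U¹¹ (needed at level 3) is itself NOT signed level
by level (`U¹¹ = −2q³(1−q)(2−q)` on the triangle strip), although every genuine level-3 instance of `C_∞` is — see the memo.
[cite: Grimmett2006, §1.4 eq. (1.20) (p. 15); §3.8 Thm. (3.90) (pp. 61–62); §3.9 (pp. 63–64)] [cite: Wagner2006, Thm. 5.8(d), §5.3]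
-/

noncomputable section

namespace Summit.CriticalPhenomena.PercolationContinuityZ3.Theorems

namespace FK

open SimpleGraph Literature.Probability.LatticeModels Literature.Probability.Percolation
open scoped Classical

variable {V : Type*}

/-! ### The Abel bridge: level partial sums control every `q ∈ [0, 1]` -/

section Abel

/-- Telescoping: for `e ≤ n`, `q^e = q^n + ∑_{J < n} 1{e ≤ J} (q^J − q^{J+1})`. [folklore] -/
theorem pow_eq_pow_add_sum_indicator (q : ℝ) {e n : ℕ} (hen : e ≤ n) :
    q ^ e = q ^ n + ∑ J ∈ Finset.range n, (if e ≤ J then q ^ J - q ^ (J + 1) else 0) := by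
  have key : ∑ J ∈ Finset.range n, (if e ≤ J then q ^ J - q ^ (J + 1) else 0) =
      ∑ J ∈ Finset.range n, (q ^ max e J - q ^ max e (J + 1)) := by
    refine Finset.sum_congr rfl fun J _ => ?_
    by_cases h : e ≤ J
    · rw [if_pos h, max_eq_right h, max_eq_right (h.trans (Nat.le_succ J))]
    · rw [if_neg h]
      push Not at h
      rw [max_eq_left h.le, max_eq_left (Nat.succ_le_of_lt h), sub_self]
  rw [key, Finset.sum_range_sub' (fun J => q ^ max e J) n, max_eq_left (Nat.zero_le e), max_eq_right hen]
  ring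

/-- **ABEL BRIDGE.**  If every level partial sum `∑_{i : e(i) ≤ J} a_i` is `≤ 0`, then `∑_i q^{e(i)} a_i ≤ 0` for every `0 ≤ q ≤ 1`
(summation by parts: `q^{e} = q^n + ∑_{J<n} 1{e ≤ J}(q^J − q^{J+1})` with nonnegative increments). [folklore] -/
theorem sum_pow_mul_nonpos_of_levels_le {ι : Type*} (s : Finset ι) (e : ι → ℕ) (a : ι → ℝ) {q : ℝ} (hq0 : 0 ≤ q) (hq1 : q ≤ 1)
    (h : ∀ J : ℕ, ∑ i ∈ s with e i ≤ J, a i ≤ 0) : ∑ i ∈ s, q ^ e i * a i ≤ 0 := by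
  set n := s.sup e with hn
  have hle : ∀ i ∈ s, e i ≤ n := fun i hi => Finset.le_sup hi
  have h1 : ∑ i ∈ s, q ^ e i * a i =
      q ^ n * ∑ i ∈ s with e i ≤ n, a i +
        ∑ J ∈ Finset.range n, (q ^ J - q ^ (J + 1)) * ∑ i ∈ s with e i ≤ J, a i := by
    have step : ∀ i ∈ s, q ^ e i * a i =
        q ^ n * a i + ∑ J ∈ Finset.range n, (q ^ J - q ^ (J + 1)) * (if e i ≤ J then a i else 0) := by
      intro i hi
      rw [pow_eq_pow_add_sum_indicator q (hle i hi), add_mul, Finset.sum_mul]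
      congr 1
      refine Finset.sum_congr rfl fun J _ => ?_
      split_ifs <;> ring
    rw [Finset.sum_congr rfl step, Finset.sum_add_distrib, ← Finset.mul_sum, Finset.sum_comm, Finset.sum_filter]
    congr 1
    · congr 1
      exact Finset.sum_congr rfl fun i hi => by rw [if_pos (hle i hi)]
    · refine Finset.sum_congr rfl fun J _ => ?_
      rw [Finset.sum_filter, Finset.mul_sum]
  rw [h1]
  have t1 : q ^ n * ∑ i ∈ s with e i ≤ n, a i ≤ 0 := mul_nonpos_of_nonneg_of_nonpos (pow_nonneg hq0 n) (h n)
  have t2 : ∑ J ∈ Finset.range n, (q ^ J - q ^ (J + 1)) * ∑ i ∈ s with e i ≤ J, a i ≤ 0 := by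
    refine Finset.sum_nonpos fun J _ => mul_nonpos_of_nonneg_of_nonpos ?_ (h J)
    have : q ^ (J + 1) ≤ q ^ J := by
      rw [pow_succ]
      exact mul_le_of_le_one_right (pow_nonneg hq0 J) hq1
    linarith
  linarith

/-- **The level form of `C_∞` implies `C_∞`.**  If for every level `J` the partial sum
`∑_{γ ⊆ M : k(γ)+k(M∖γ) ≤ J} (f γ − f γᶜ)(g γ − g γᶜ)` is `≤ 0`, then `apPsi q M f g ≤ 0` for every `0 ≤ q ≤ 1`.
[cite: Grimmett2006, §3.9 (pp. 63–64)] -/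
theorem apPsi_nonpos_of_levels_le_nonpos {q : ℝ} (hq0 : 0 ≤ q) (hq1 : q ≤ 1) (M : Finset (Sym2 V)) (f g : Finset (Sym2 V) → ℝ)
    (h : ∀ J : ℕ, ∑ γ ∈ M.powerset with apExp M γ ≤ J, (f γ - f (M \ γ)) * (g γ - g (M \ γ)) ≤ 0) :
    apPsi q M f g ≤ 0 :=
  sum_pow_mul_nonpos_of_levels_le M.powerset (apExp M) (fun γ => (f γ - f (M \ γ)) * (g γ - g (M \ γ))) hq0 hq1 h

end Abel

/-! ### Integrating out a pivot edge against a general level weight -/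

section Pivot

variable [Fintype V] {s t : V}

/-- **The weighted pivot identity.**  For `x = st ∉ M`, `g` not reading `x` and ANY weight sequence `w`:
`∑_{γ ⊆ M ∪ {x}} w(k(γ)+k(γᶜ)) (1_x γ − 1_x γᶜ)(g γ − g γᶜ) = − apUpcLW (n ↦ w(n−1) − w(n)) M s t (γ ↦ g γ − g(M∖γ))`
(opening `x` on the side where `s ↮ t` lowers the level by one: `FK.clusterCount_union_pair_add`). [folklore] -/
theorem apPsiW_pivot_eq (w : ℕ → ℝ) {M : Finset (Sym2 V)} (hst : s(s, t) ∉ M) {g : Finset (Sym2 V) → ℝ}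
    (hg : ∀ A : Finset (Sym2 V), g (insert s(s, t) A) = g A) :
    ∑ γ ∈ (insert s(s, t) M).powerset, w (apExp (insert s(s, t) M) γ) *
        (((if s(s, t) ∈ γ then (1 : ℝ) else 0) - (if s(s, t) ∈ insert s(s, t) M \ γ then 1 else 0)) *
          (g γ - g (insert s(s, t) M \ γ))) =
      - apUpcLW (fun n => w (n - 1) - w n) M s t (fun γ => g γ - g (M \ γ)) := by
  unfold apUpcLW
  rw [Finset.sum_powerset_insert hst, ← Finset.sum_add_distrib, ← Finset.sum_neg_distrib]
  refine Finset.sum_congr rfl fun γ hγ => ?_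
  have hγM : γ ⊆ M := Finset.mem_powerset.1 hγ
  have hxγ : s(s, t) ∉ γ := fun h => hst (hγM h)
  have hxc : s(s, t) ∉ M \ γ := fun h => hst (Finset.sdiff_subset h)
  have e1 : insert s(s, t) M \ γ = insert s(s, t) (M \ γ) := Finset.insert_sdiff_of_notMem M hxγ
  have e2 : insert s(s, t) M \ insert s(s, t) γ = M \ γ := by
    rw [Finset.insert_sdiff_insert, Finset.sdiff_insert_of_notMem hst]
  rw [e1, e2]
  simp only [hxγ, hxc, Finset.mem_insert_self, if_true, if_false, hg]
  have k1 := clusterCount_union_pair_add (↑γ : BondConfig V) s t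
  have k2 := clusterCount_union_pair_add (↑(M \ γ) : BondConfig V) s t
  have c1 : (↑(insert s(s, t) γ) : BondConfig V) = ↑γ ∪ {s(s, t)} := by
    rw [Finset.coe_insert, Set.insert_eq, Set.union_comm]
  have c2 : (↑(insert s(s, t) (M \ γ)) : BondConfig V) = ↑(M \ γ) ∪ {s(s, t)} := by
    rw [Finset.coe_insert, Set.insert_eq, Set.union_comm]
  have ex1 : apExp (insert s(s, t) M) (insert s(s, t) γ) + 1 =
      apExp M γ + (if (openGraph (↑γ : BondConfig V)).Reachable s t then 1 else 0) := by
    unfold apExp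
    rw [e2, c1]
    split_ifs at k1 with hr
    · rw [if_pos hr]; omega
    · rw [if_neg hr]; omega
  have ex2 : apExp (insert s(s, t) M) γ + 1 =
      apExp M γ + (if (openGraph (↑(M \ γ) : BondConfig V)).Reachable s t then 1 else 0) := by
    unfold apExp
    rw [e1, c2]
    split_ifs at k2 with hr
    · rw [if_pos hr]; omega
    · rw [if_neg hr]; omega
  unfold apConn
  by_cases a₁ : (openGraph (↑γ : BondConfig V)).Reachable s t <;>
  by_cases b₁ : (openGraph (↑(M \ γ) : BondConfig V)).Reachable s t <;>
  simp only [a₁, b₁, if_true, if_false] at ex1 ex2 ⊢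
  · -- both sides joined: both configurations sit at level `apExp M γ`
    have h1 : apExp (insert s(s, t) M) (insert s(s, t) γ) = apExp M γ := by omega
    have h2 : apExp (insert s(s, t) M) γ = apExp M γ := by omega
    rw [h1, h2]; ring
  · -- `s ↔ t` in `γ` only: `γ ∪ {x}` at level `e`, `γ` at level `e − 1`
    have h1 : apExp (insert s(s, t) M) (insert s(s, t) γ) = apExp (insert s(s, t) M) γ + 1 := by omega
    have h2 : apExp M γ = apExp (insert s(s, t) M) γ + 1 := by omega
    rw [h1, h2, Nat.add_sub_cancel]; ring
  · -- `s ↔ t` in `γᶜ` only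
    have h1 : apExp (insert s(s, t) M) γ = apExp (insert s(s, t) M) (insert s(s, t) γ) + 1 := by omega
    have h2 : apExp M γ = apExp (insert s(s, t) M) (insert s(s, t) γ) + 1 := by omega
    rw [h1, h2, Nat.add_sub_cancel]; ring
  · -- neither joined: both configurations at level `e − 1`
    have h1 : apExp (insert s(s, t) M) (insert s(s, t) γ) = apExp (insert s(s, t) M) γ := by omega
    rw [h1]; ring

/-- **Level form of `C_∞` at `|supp f| = 1`, rooted version.**  `M ⊆ E` with `E` TTSP between `s, t`, `x = st ∉ E`, `w` ANTITONE,
`g` increasing on the subsets of `M` and not reading `x` ⟹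
`∑_{γ ⊆ M ∪ {x}} w(k(γ)+k(γᶜ)) (1_x γ − 1_x γᶜ)(g γ − g γᶜ) ≤ 0` (gen 18's coefficientwise Theorem U `FK.apUpcLW_nonneg_of_isTTSP` applied
to the nonnegative weight `n ↦ w(n−1) − w(n)` and the increasing test function `γ ↦ g γ − g(M∖γ)`).
[cite: Grimmett2006, §3.8 Thm. (3.90) (pp. 61–62); §3.9 (pp. 63–64)] [cite: Wagner2006, Thm. 5.8(d), §5.3] -/
theorem apPsiW_pivot_nonpos_of_isTTSP {E M : Finset (Sym2 V)} (hE : IsTTSP E s t) (hM : M ⊆ E) (hst : s(s, t) ∉ E)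
    {w : ℕ → ℝ} (hw : ∀ n : ℕ, w (n + 1) ≤ w n) {g : Finset (Sym2 V) → ℝ}
    (hg : ∀ A : Finset (Sym2 V), g (insert s(s, t) A) = g A)
    (hmono : ∀ ⦃A B : Finset (Sym2 V)⦄, A ⊆ B → B ⊆ M → g A ≤ g B) :
    ∑ γ ∈ (insert s(s, t) M).powerset, w (apExp (insert s(s, t) M) γ) *
        (((if s(s, t) ∈ γ then (1 : ℝ) else 0) - (if s(s, t) ∈ insert s(s, t) M \ γ then 1 else 0)) *
          (g γ - g (insert s(s, t) M \ γ))) ≤ 0 := by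
  rw [apPsiW_pivot_eq w (fun h => hst (hM h)) hg, neg_nonpos]
  refine apUpcLW_nonneg_of_isTTSP hE M hM (fun n => w (n - 1) - w n) (fun n => ?_) (fun γ => g γ - g (M \ γ)) ?_
  · cases n with
    | zero => simp
    | succ k => rw [Nat.add_sub_cancel]; linarith [hw k]
  · intro A B hAB hBM
    have h1 := hmono hAB hBM
    have h2 := hmono (Finset.sdiff_subset_sdiff (le_refl M) hAB) Finset.sdiff_subset
    linarith

/-- **Level form of `C_∞` at `|supp f| = 1`, at any position of any sub-host.**  `E` TTSP between `s, t`, `st ∉ E`, `M ⊆ E ∪ {st}`,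
`a ∈ M`, `w` antitone, `g` increasing on the subsets of `M` and not reading `a` ⟹
`∑_{γ ⊆ M} w(k(γ)+k(M∖γ)) (1_a γ − 1_a γᶜ)(g γ − g γᶜ) ≤ 0` (Duffin re-rooting at `a`, `FK.IsTTSP.reroot_erase`).
[cite: Grimmett2006, §3.8 Thm. (3.90) (pp. 61–62); §3.9 (pp. 63–64)] [cite: Wagner2006, Thm. 5.8(d), §5.3] -/
theorem apPsiW_pivot_sub_nonpos_of_isTTSP {E : Finset (Sym2 V)} (hE : IsTTSP E s t) (hst : s(s, t) ∉ E) {M : Finset (Sym2 V)}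
    (hM : M ⊆ insert s(s, t) E) {a : Sym2 V} (ha : a ∈ M) {w : ℕ → ℝ} (hw : ∀ n : ℕ, w (n + 1) ≤ w n)
    {g : Finset (Sym2 V) → ℝ} (hga : ∀ A : Finset (Sym2 V), g (insert a A) = g A)
    (hmono : ∀ ⦃A B : Finset (Sym2 V)⦄, A ⊆ B → B ⊆ M → g A ≤ g B) :
    ∑ γ ∈ M.powerset, w (apExp M γ) *
        (((if a ∈ γ then (1 : ℝ) else 0) - (if a ∈ M \ γ then 1 else 0)) * (g γ - g (M \ γ))) ≤ 0 := by
  induction a using Sym2.ind with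
  | h a₁ a₂ =>
    have hR := hE.reroot_erase (hM ha) (insert_ne_singleton_of_isTTSP hE hst _)
    have hMa : M.erase s(a₁, a₂) ⊆ (insert s(s, t) E).erase s(a₁, a₂) := Finset.erase_subset_erase _ hM
    have key := apPsiW_pivot_nonpos_of_isTTSP hR hMa (Finset.notMem_erase _ _) hw hga
      (fun A B hAB hB => hmono hAB (hB.trans (Finset.erase_subset _ _)))
    rw [Finset.insert_erase ha] at key
    exact key

/-- **Level form of `C_∞` at `|supp f| = 1`, partial sums.**  Under the hypotheses of `FK.apPsiW_pivot_sub_nonpos_of_isTTSP`, for every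
level `J`: `∑_{γ ⊆ M : k(γ)+k(M∖γ) ≤ J} (1_a γ − 1_a γᶜ)(g γ − g γᶜ) ≤ 0` — i.e. `apPsi q M 1_a g / (q − 1)` has nonnegative coefficients.
[cite: Grimmett2006, §3.8 Thm. (3.90) (pp. 61–62); §3.9 (pp. 63–64)] [cite: Wagner2006, Thm. 5.8(d), §5.3] -/
theorem apPsi_levels_le_pivot_nonpos_of_isTTSP {E : Finset (Sym2 V)} (hE : IsTTSP E s t) (hst : s(s, t) ∉ E) {M : Finset (Sym2 V)}
    (hM : M ⊆ insert s(s, t) E) {a : Sym2 V} (ha : a ∈ M) (J : ℕ)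
    {g : Finset (Sym2 V) → ℝ} (hga : ∀ A : Finset (Sym2 V), g (insert a A) = g A)
    (hmono : ∀ ⦃A B : Finset (Sym2 V)⦄, A ⊆ B → B ⊆ M → g A ≤ g B) :
    ∑ γ ∈ M.powerset with apExp M γ ≤ J,
        ((if a ∈ γ then (1 : ℝ) else 0) - (if a ∈ M \ γ then 1 else 0)) * (g γ - g (M \ γ)) ≤ 0 := by
  have key := apPsiW_pivot_sub_nonpos_of_isTTSP hE hst hM ha (w := fun n => if n ≤ J then (1 : ℝ) else 0)
    (fun n => by
      split_ifs with h1 h2 h2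
      · exact le_rfl
      · exact absurd ((Nat.le_succ n).trans h1) h2
      · exact zero_le_one
      · exact le_rfl) hga hmono
  rw [Finset.sum_filter]
  refine le_of_eq_of_le (Finset.sum_congr rfl fun γ _ => ?_) key
  split_ifs <;> ring

end Pivot

/-! ### Level 2: every increasing `f` reading two edges -/

section Level2

variable [Fintype V] {s t : V}

omit [Fintype V] in
/-- **The odd part of a two-edge function.**  `f` reading only `a, b ∈ M` ⟹ for every `γ`:
`f γ − f(M∖γ) = α (1_a γ − 1_a γᶜ) + β (1_b γ − 1_b γᶜ)` with `α = (f{a,b} − f∅ + f{a} − f{b})/2`, `β = (f{a,b} − f∅ − f{a} + f{b})/2`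
(also for `a = b`). [folklore] -/
theorem odd_level2_eq {M : Finset (Sym2 V)} {a b : Sym2 V} (ha : a ∈ M) (hb : b ∈ M) {f : Finset (Sym2 V) → ℝ}
    (hf : ∀ e : Sym2 V, e ∉ ({a, b} : Finset (Sym2 V)) → ∀ A : Finset (Sym2 V), f (insert e A) = f A)
    (γ : Finset (Sym2 V)) :
    f γ - f (M \ γ) =
      (f {a, b} - f ∅ + f {a} - f {b}) / 2 * ((if a ∈ γ then (1 : ℝ) else 0) - (if a ∈ M \ γ then 1 else 0)) +
        (f {a, b} - f ∅ - f {a} + f {b}) / 2 * ((if b ∈ γ then (1 : ℝ) else 0) - (if b ∈ M \ γ then 1 else 0)) := by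
  have hfS := eq_inter_of_notRead_outside hf
  have hac : a ∈ M \ γ ↔ a ∉ γ := by rw [Finset.mem_sdiff]; exact ⟨fun h => h.2, fun h => ⟨ha, h⟩⟩
  have hbc : b ∈ M \ γ ↔ b ∉ γ := by rw [Finset.mem_sdiff]; exact ⟨fun h => h.2, fun h => ⟨hb, h⟩⟩
  rw [hfS γ, hfS (M \ γ), Finset.inter_comm γ, Finset.inter_comm (M \ γ)]
  by_cases p : a ∈ γ <;> by_cases r : b ∈ γ <;>
  simp only [Finset.inter_insert, Finset.singleton_inter, hac, hbc, p, r, Finset.insert_empty,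
    if_true, if_false, not_true_eq_false, not_false_eq_true] <;> ring

/-- **Level form of `C_∞` at `|supp f| = 2`, general antitone weight.**  `E` TTSP between `s, t`, `st ∉ E`, `M ⊆ E ∪ {st}`, `a, b ∈ M` (possibly equal),
`w` antitone, `f` increasing on the subsets of `{a, b}` reading no other edge, `g` increasing on the subsets of `M` reading neither `a` nor
`b` ⟹ `∑_{γ ⊆ M} w(k(γ)+k(M∖γ)) (f γ − f γᶜ)(g γ − g γᶜ) ≤ 0`.
[cite: Grimmett2006, §3.8 Thm. (3.90) (pp. 61–62); §3.9 (pp. 63–64)] [cite: Wagner2006, Thm. 5.8(d), §5.3] -/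
theorem apPsiW_level2_nonpos_of_isTTSP {E : Finset (Sym2 V)} (hE : IsTTSP E s t) (hst : s(s, t) ∉ E) {M : Finset (Sym2 V)}
    (hM : M ⊆ insert s(s, t) E) {a b : Sym2 V} (ha : a ∈ M) (hb : b ∈ M) {w : ℕ → ℝ}
    (hw : ∀ n : ℕ, w (n + 1) ≤ w n) {f g : Finset (Sym2 V) → ℝ}
    (hf : ∀ e : Sym2 V, e ∉ ({a, b} : Finset (Sym2 V)) → ∀ A : Finset (Sym2 V), f (insert e A) = f A)
    (hfmono : ∀ ⦃A B : Finset (Sym2 V)⦄, A ⊆ B → B ⊆ ({a, b} : Finset (Sym2 V)) → f A ≤ f B)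
    (hga : ∀ A : Finset (Sym2 V), g (insert a A) = g A) (hgb : ∀ A : Finset (Sym2 V), g (insert b A) = g A)
    (hmono : ∀ ⦃A B : Finset (Sym2 V)⦄, A ⊆ B → B ⊆ M → g A ≤ g B) :
    ∑ γ ∈ M.powerset, w (apExp M γ) * ((f γ - f (M \ γ)) * (g γ - g (M \ γ))) ≤ 0 := by
  have sub : ∀ A : Finset (Sym2 V), (∀ e ∈ A, e = a ∨ e = b) → A ⊆ ({a, b} : Finset (Sym2 V)) := fun A hA e he => by
    simp only [Finset.mem_insert, Finset.mem_singleton]; exact hA e he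
  have m1 : f ∅ ≤ f {a} := hfmono (Finset.empty_subset _) (sub _ (by simp))
  have m2 : f ∅ ≤ f {b} := hfmono (Finset.empty_subset _) (sub _ (by simp))
  have m3 : f {a} ≤ f {a, b} := hfmono (by intro e; simp only [Finset.mem_insert, Finset.mem_singleton]; tauto) (sub _ (by simp))
  have m4 : f {b} ≤ f {a, b} := hfmono (by intro e; simp only [Finset.mem_insert, Finset.mem_singleton]; tauto) (sub _ (by simp))
  have hα : 0 ≤ (f {a, b} - f ∅ + f {a} - f {b}) / 2 := by linarith
  have hβ : 0 ≤ (f {a, b} - f ∅ - f {a} + f {b}) / 2 := by linarith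
  have Ua := apPsiW_pivot_sub_nonpos_of_isTTSP hE hst hM ha hw hga hmono
  have Ub := apPsiW_pivot_sub_nonpos_of_isTTSP hE hst hM hb hw hgb hmono
  have split : ∑ γ ∈ M.powerset, w (apExp M γ) * ((f γ - f (M \ γ)) * (g γ - g (M \ γ))) =
      (f {a, b} - f ∅ + f {a} - f {b}) / 2 *
          ∑ γ ∈ M.powerset, w (apExp M γ) *
            (((if a ∈ γ then (1 : ℝ) else 0) - (if a ∈ M \ γ then 1 else 0)) * (g γ - g (M \ γ))) +
        (f {a, b} - f ∅ - f {a} + f {b}) / 2 *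
          ∑ γ ∈ M.powerset, w (apExp M γ) *
            (((if b ∈ γ then (1 : ℝ) else 0) - (if b ∈ M \ γ then 1 else 0)) * (g γ - g (M \ γ))) := by
    rw [Finset.mul_sum, Finset.mul_sum, ← Finset.sum_add_distrib]
    refine Finset.sum_congr rfl fun γ _ => ?_
    rw [odd_level2_eq ha hb hf γ]
    ring
  rw [split]
  nlinarith

/-- **Level form of `C_∞` at `|supp f| = 2`, partial sums.**  Under the hypotheses of `FK.apPsiW_level2_nonpos_of_isTTSP`, for every
level `J`: `∑_{γ ⊆ M : k(γ)+k(M∖γ) ≤ J} (f γ − f γᶜ)(g γ − g γᶜ) ≤ 0`; hence `apPsi q M f g / (q − 1)` has nonnegative coefficients and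
(`FK.apPsi_nonpos_of_levels_le_nonpos`) `apPsi q M f g ≤ 0` for `0 ≤ q ≤ 1`.
[cite: Grimmett2006, §3.8 Thm. (3.90) (pp. 61–62); §3.9 (pp. 63–64)] [cite: Wagner2006, Thm. 5.8(d), §5.3] -/
theorem apPsi_levels_le_level2_nonpos_of_isTTSP {E : Finset (Sym2 V)} (hE : IsTTSP E s t) (hst : s(s, t) ∉ E) {M : Finset (Sym2 V)}
    (hM : M ⊆ insert s(s, t) E) {a b : Sym2 V} (ha : a ∈ M) (hb : b ∈ M) (J : ℕ)
    {f g : Finset (Sym2 V) → ℝ}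
    (hf : ∀ e : Sym2 V, e ∉ ({a, b} : Finset (Sym2 V)) → ∀ A : Finset (Sym2 V), f (insert e A) = f A)
    (hfmono : ∀ ⦃A B : Finset (Sym2 V)⦄, A ⊆ B → B ⊆ ({a, b} : Finset (Sym2 V)) → f A ≤ f B)
    (hga : ∀ A : Finset (Sym2 V), g (insert a A) = g A) (hgb : ∀ A : Finset (Sym2 V), g (insert b A) = g A)
    (hmono : ∀ ⦃A B : Finset (Sym2 V)⦄, A ⊆ B → B ⊆ M → g A ≤ g B) :
    ∑ γ ∈ M.powerset with apExp M γ ≤ J, (f γ - f (M \ γ)) * (g γ - g (M \ γ)) ≤ 0 := by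
  have key := apPsiW_level2_nonpos_of_isTTSP hE hst hM ha hb (w := fun n => if n ≤ J then (1 : ℝ) else 0)
    (fun n => by
      split_ifs with h1 h2 h2
      · exact le_rfl
      · exact absurd ((Nat.le_succ n).trans h1) h2
      · exact zero_le_one
      · exact le_rfl) hf hfmono hga hgb hmono
  rw [Finset.sum_filter]
  refine le_of_eq_of_le (Finset.sum_congr rfl fun γ _ => ?_) key
  split_ifs <;> ring

/-- **Sanity corollary (value level recovered).**  Under the same hypotheses, `apPsi q M f g ≤ 0` for every `0 ≤ q ≤ 1` — gen 11's
two-edge theorem, now via the level form and the Abel bridge (and including `q = 0`). [cite: Grimmett2006, §3.9 (pp. 63–64)] -/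
theorem apPsi_level2_nonpos_of_levels {q : ℝ} (hq0 : 0 ≤ q) (hq1 : q ≤ 1) {E : Finset (Sym2 V)} (hE : IsTTSP E s t)
    (hst : s(s, t) ∉ E) {M : Finset (Sym2 V)} (hM : M ⊆ insert s(s, t) E) {a b : Sym2 V} (ha : a ∈ M) (hb : b ∈ M)
    {f g : Finset (Sym2 V) → ℝ}
    (hf : ∀ e : Sym2 V, e ∉ ({a, b} : Finset (Sym2 V)) → ∀ A : Finset (Sym2 V), f (insert e A) = f A)
    (hfmono : ∀ ⦃A B : Finset (Sym2 V)⦄, A ⊆ B → B ⊆ ({a, b} : Finset (Sym2 V)) → f A ≤ f B)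
    (hga : ∀ A : Finset (Sym2 V), g (insert a A) = g A) (hgb : ∀ A : Finset (Sym2 V), g (insert b A) = g A)
    (hmono : ∀ ⦃A B : Finset (Sym2 V)⦄, A ⊆ B → B ⊆ M → g A ≤ g B) :
    apPsi q M f g ≤ 0 :=
  apPsi_nonpos_of_levels_le_nonpos hq0 hq1 M f g fun J =>
    apPsi_levels_le_level2_nonpos_of_isTTSP hE hst hM ha hb J hf hfmono hga hgb hmono

end Level2

end FK

end Summit.CriticalPhenomena.PercolationContinuityZ3.Theorems

end
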